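import Summits.RiemannHypothesis.RiemannHypothesis.Theorems.WeilFormatCPolyWindowMixedIncrement
import Summits.RiemannHypothesis.RiemannHypothesis.Theorems.WeilFormatCPolyWindowArch
import Summits.RiemannHypothesis.RiemannHypothesis.Theorems.WeilFormatCEntryArchSeries
import HarnessLib

/-!
# Format C, design C∞ (L2–VI): the archimedean integrals of the mixed entries — `∫ρ(1 − e^{±iω_m t})` and the
  polynomial kernels

Route context: Fourier–Galerkin / Schur-complement certificates of Weil positivity on a window ("format C";
cell memo `run/shared/lean/pub/rh-explicit/rh-explicit-weil-10/FORMATC-DESIGN.md` §9.12.7–§9.12.11; supporting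
stmt-RiemannHypothesis-0098; seat rh-explicit-weil-10).  By `WeilFormatCPolyWindowMixedIncrement.weilIncrementSesq_indicator_pow_chi`
the increment pairing `D_t(1x^j, χ_m)` on the window scale is a finite combination of `1 − e^{iω_m t}`, `1 − e^{−iω_m t}` and
the polynomials `P_q(t) = (a^q − (a−t)^q) + ((−a+t)^q − (−a)^q)` (`q = j − k`), all vanishing at `t = 0`.  This file
evaluates their integrals against the archimedean density `ρ(t) = e^{t/2}/(2 sinh t) = Σ_k e^{−l_k t}` on `(0, 2a]`:

* `setIntegral_weilArchDensity_mul_one_sub_cos` —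
  `∫_{(0,2a]} ρ(t)(1 − cos ω_m t) dt = ½(Re ψ(¼ + iω_m/2) − ψ(¼)) − ½ Σ_k e^{−2a l_k} f_{l_k}(ω_m)`,
  `f_l(ω) = 2ω²/(l(l²+ω²))` (`digammaTerm`; node-wise `∫_0^{2a} e^{−lt}(1 − cos ωt) = (1 − e^{−2al}) f_l(ω)/2`, then the
  tree's vertical digamma series `hasSum_digammaTerm`) — the companion of `setIntegral_weilArchDensity_mul_sin`
  (`½ Im ψ(¼ + iω_m/2) − Σ_k e^{−2al_k} ω_m/(l_k² + ω_m²)`);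
* `setIntegral_weilArchDensity_mul_one_sub_cexp` / `…_neg` — the complex forms
  `∫_{(0,2a]} ρ(1 − e^{iω_m t}) = J_c − iJ_s`, `∫_{(0,2a]} ρ(1 − e^{−iω_m t}) = J_c + iJ_s` and their integrability;
* `mixedPolyKernel_eq_sum` — `P_q(t) = Σ_{l<q} C(q,l+1)((−a)^{q−l−1} + (−1)^l a^{q−l−1}) t^{l+1}` (so `P_q = 0` for even `q`),
  hence `∫_{(0,2a]} ρ P_q = Σ_l (…)·W_{l+1}(a)` through the window constants of `WeilFormatCPolyWindowArch.lean`
  (`setIntegral_weilArchDensity_mul_mixedPolyKernel`).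

Pure calculus; standard axioms; no RH claim.
-/

set_option autoImplicit false
-- `Summit.RiemannHypothesis.RiemannHypothesis.…` is the layout-mandated namespace (summit = problem name).
set_option linter.dupNamespace false

noncomputable section

open Complex Filter Set MeasureTheory
open scoped Real Topology ComplexConjugate

namespace Summit.RiemannHypothesis.RiemannHypothesis.Theorems.WeilFormatC

open Literature.NumberTheory.LFunctions Literature.Analysis.SpecialFunctions

variable {a : ℝ}

/-! ## `∫_{(0,2a]} ρ(t)(1 − cos ωt) dt` -/

/-- `|1 − cos(ωt)| ≤ |ω| t` for `t ≥ 0`. -/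
theorem abs_one_sub_cos_mul_le {ω t : ℝ} (ht : 0 ≤ t) : |1 - Real.cos (ω * t)| ≤ |ω| * t := by
  have h := Real.abs_cos_sub_cos_le 0 (ω * t)
  rw [Real.cos_zero, zero_sub, abs_neg, abs_mul, abs_of_nonneg ht] at h
  exact h

/-- `ρ(t)(1 − cos ω_m t)` is integrable on `(0, 2a]` (`a > 0`). -/
theorem integrableOn_weilArchDensity_mul_one_sub_cos (ha : 0 < a) (ω : ℝ) :
    IntegrableOn (fun t ↦ weilArchDensity t * (1 - Real.cos (ω * t))) (Ioc 0 (2 * a)) :=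
  integrableOn_weilArchDensity_mul (by positivity) (by fun_prop : Continuous fun t : ℝ ↦ 1 - Real.cos (ω * t)).continuousOn
    (C := |ω|) fun _ ht ↦ abs_one_sub_cos_mul_le ht.1.le

/-- `0 ≤ f_l(ω) ≤ 4` for the nodes `l = l_k ≥ ½`. -/
theorem abs_digammaTerm_digammaNode_le (ω : ℝ) (k : ℕ) : |digammaTerm (digammaNode k) ω| ≤ 4 := by
  have hl := digammaNode_pos k
  have hl2 := one_half_le_digammaNode k
  rw [abs_of_nonneg (digammaTerm_nonneg hl ω), digammaTerm_eq hl]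
  have h1 : 0 ≤ 2 * digammaNode k / (digammaNode k ^ 2 + ω ^ 2) := by positivity
  have h2 : 2 / digammaNode k ≤ 4 := by
    rw [div_le_iff₀ hl]; linarith
  linarith

/-- The window-truncated digamma-term sum `Σ_k e^{−2a l_k} f_{l_k}(ω)/2` converges (`a > 0`). -/
theorem summable_exp_mul_digammaTerm (ha : 0 < a) (ω : ℝ) :
    Summable (fun k : ℕ ↦ Real.exp (-(2 * a * digammaNode k)) * (digammaTerm (digammaNode k) ω / 2)) :=
  summable_exp_neg_mul_of_bounded ha (C := 2) fun k ↦ by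
    rw [abs_div, abs_two]
    linarith [abs_digammaTerm_digammaNode_le ω k]

/-- **`∫_{(0,2a]} ρ(t)(1 − cos ω_m t) dt = ½(Re ψ(¼ + iω_m/2) − ψ(¼)) − Σ_k e^{−2a l_k} f_{l_k}(ω_m)/2`**, `ω_m = πm/a`
(`a > 0`; uses `cos(2aω_m) = 1`; `reDigammaQuarter t = Re ψ(¼ + it/2)`, `reDigammaQuarter 0 = ψ(¼)`). -/
theorem setIntegral_weilArchDensity_mul_one_sub_cos (ha : 0 < a) (m : ℤ) :
    ∫ t in Ioc 0 (2 * a), weilArchDensity t * (1 - Real.cos (π * m / a * t)) =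
      (reDigammaQuarter (π * m / a) - reDigammaQuarter 0) / 2 -
        ∑' k : ℕ, Real.exp (-(2 * a * digammaNode k)) * (digammaTerm (digammaNode k) (π * m / a) / 2) := by
  set ω : ℝ := π * m / a with hω
  have hT : (0 : ℝ) < 2 * a := by positivity
  have hωT : ω * (2 * a) = 2 * π * m := by rw [hω]; field_simp
  have h1 := hasSum_setIntegral_exp_mul hT (K := fun t ↦ 1 - Real.cos (ω * t)) (C := |ω|)
    (by fun_prop) (fun t ht ↦ abs_one_sub_cos_mul_le ht.1.le)
  have hterm : ∀ k : ℕ, ∫ t in Ioc 0 (2 * a), Real.exp (-(digammaNode k * t)) * (1 - Real.cos (ω * t)) =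
      digammaTerm (digammaNode k) ω / 2 -
        Real.exp (-(2 * a * digammaNode k)) * (digammaTerm (digammaNode k) ω / 2) := by
    intro k
    have hl := digammaNode_pos k
    have hs : digammaNode k ^ 2 + ω ^ 2 ≠ 0 := by positivity
    have i1 : IntervalIntegrable (fun t ↦ Real.exp (-(digammaNode k * t))) volume 0 (2 * a) := by
      apply Continuous.intervalIntegrable; fun_prop
    have i2 : IntervalIntegrable (fun t ↦ Real.exp (-(digammaNode k * t)) * Real.cos (ω * t)) volume 0 (2 * a) := by
      apply Continuous.intervalIntegrable; fun_prop
    have hpt : ∀ t : ℝ, Real.exp (-(digammaNode k * t)) * (1 - Real.cos (ω * t)) =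
        Real.exp (-(digammaNode k * t)) - Real.exp (-(digammaNode k * t)) * Real.cos (ω * t) := fun t ↦ by ring
    rw [← intervalIntegral.integral_of_le hT.le]
    simp_rw [hpt]
    rw [intervalIntegral.integral_sub i1 i2, integral_exp_neg_mul hl.ne', integral_exp_neg_mul_cos hωT hs,
      digammaTerm_eq hl, show digammaNode k * (2 * a) = 2 * a * digammaNode k by ring]
    ring
  simp_rw [hterm] at h1
  have h2 : HasSum (fun k : ℕ ↦ digammaTerm (digammaNode k) ω / 2) ((reDigammaQuarter ω - reDigammaQuarter 0) / 2) :=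
    (hasSum_digammaTerm ω).div_const 2
  have h3 := (summable_exp_mul_digammaTerm ha ω).hasSum
  exact h1.unique (h2.sub h3)

/-! ## The complex forms `∫_{(0,2a]} ρ(t)(1 − e^{±iωt}) dt` -/

/-- `1 − e^{iωt} = (1 − cos ωt) − i sin ωt` with real `cos`, `sin`. -/
theorem one_sub_cexp_freq (ω t : ℝ) :
    (1 : ℂ) - cexp (I * (ω : ℂ) * (t : ℂ)) = ((1 - Real.cos (ω * t) : ℝ) : ℂ) - I * ((Real.sin (ω * t) : ℝ) : ℂ) := by
  rw [show I * (ω : ℂ) * (t : ℂ) = ((ω * t : ℝ) : ℂ) * I by push_cast; ring, Complex.exp_mul_I,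
    ← Complex.ofReal_cos, ← Complex.ofReal_sin]
  push_cast
  ring

/-- `1 − e^{−iωt} = (1 − cos ωt) + i sin ωt` with real `cos`, `sin`. -/
theorem one_sub_cexp_neg_freq (ω t : ℝ) :
    (1 : ℂ) - cexp (-(I * (ω : ℂ) * (t : ℂ))) = ((1 - Real.cos (ω * t) : ℝ) : ℂ) + I * ((Real.sin (ω * t) : ℝ) : ℂ) := by
  rw [show -(I * (ω : ℂ) * (t : ℂ)) = ((-(ω * t) : ℝ) : ℂ) * I by push_cast; ring, Complex.exp_mul_I,
    ← Complex.ofReal_cos, ← Complex.ofReal_sin, Real.cos_neg, Real.sin_neg]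
  push_cast
  ring

/-- `ρ(t) sin ωt` is integrable on `(0, 2a]` (real frequency `ω`; `a > 0`). -/
theorem integrableOn_weilArchDensity_mul_sin_real (ha : 0 < a) (ω : ℝ) :
    IntegrableOn (fun t ↦ weilArchDensity t * Real.sin (ω * t)) (Ioc 0 (2 * a)) :=
  integrableOn_weilArchDensity_mul (by positivity) (by fun_prop : Continuous fun t : ℝ ↦ Real.sin (ω * t)).continuousOn
    (C := |ω|) fun _ ht ↦ abs_sin_mul_le ht.1.le

/-- `ρ(t)(1 − e^{iωt})` is integrable on `(0, 2a]` (`a > 0`). -/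
theorem integrableOn_weilArchDensity_mul_one_sub_cexp (ha : 0 < a) (ω : ℝ) :
    IntegrableOn (fun t : ℝ ↦ (weilArchDensity t : ℂ) * (1 - cexp (I * (ω : ℂ) * (t : ℂ)))) (Ioc 0 (2 * a)) := by
  have h1 : IntegrableOn (fun t ↦ ((weilArchDensity t * (1 - Real.cos (ω * t)) : ℝ) : ℂ)) (Ioc 0 (2 * a)) :=
    (integrableOn_weilArchDensity_mul_one_sub_cos ha ω).ofReal
  have h2 : IntegrableOn (fun t ↦ I * ((weilArchDensity t * Real.sin (ω * t) : ℝ) : ℂ)) (Ioc 0 (2 * a)) :=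
    (integrableOn_weilArchDensity_mul_sin_real ha ω).ofReal.const_mul I
  have h3 : IntegrableOn (fun t ↦ ((weilArchDensity t * (1 - Real.cos (ω * t)) : ℝ) : ℂ) -
      I * ((weilArchDensity t * Real.sin (ω * t) : ℝ) : ℂ)) (Ioc 0 (2 * a)) := h1.sub h2
  refine h3.congr_fun (fun t _ ↦ ?_) measurableSet_Ioc
  simp only [one_sub_cexp_freq]
  push_cast
  ring

/-- `ρ(t)(1 − e^{−iωt})` is integrable on `(0, 2a]` (`a > 0`). -/
theorem integrableOn_weilArchDensity_mul_one_sub_cexp_neg (ha : 0 < a) (ω : ℝ) :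
    IntegrableOn (fun t : ℝ ↦ (weilArchDensity t : ℂ) * (1 - cexp (-(I * (ω : ℂ) * (t : ℂ))))) (Ioc 0 (2 * a)) := by
  have h := integrableOn_weilArchDensity_mul_one_sub_cexp ha (-ω)
  refine h.congr_fun (fun t _ ↦ ?_) measurableSet_Ioc
  dsimp only
  rw [show I * (((-ω : ℝ)) : ℂ) * (t : ℂ) = -(I * (ω : ℂ) * (t : ℂ)) by push_cast; ring]

/-- **`∫_{(0,2a]} ρ(t)(1 − e^{iωt}) dt = J_c − i J_s`**, `J_c = ∫_{(0,2a]} ρ(1 − cos ωt)`, `J_s = ∫_{(0,2a]} ρ sin ωt` (`a > 0`). -/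
theorem setIntegral_weilArchDensity_mul_one_sub_cexp (ha : 0 < a) (ω : ℝ) :
    ∫ t in Ioc 0 (2 * a), (weilArchDensity t : ℂ) * (1 - cexp (I * (ω : ℂ) * (t : ℂ))) =
      ((∫ t in Ioc 0 (2 * a), weilArchDensity t * (1 - Real.cos (ω * t)) : ℝ) : ℂ) -
        I * ((∫ t in Ioc 0 (2 * a), weilArchDensity t * Real.sin (ω * t) : ℝ) : ℂ) := by
  have h1 : IntegrableOn (fun t ↦ ((weilArchDensity t * (1 - Real.cos (ω * t)) : ℝ) : ℂ)) (Ioc 0 (2 * a)) :=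
    (integrableOn_weilArchDensity_mul_one_sub_cos ha ω).ofReal
  have h2 : IntegrableOn (fun t ↦ I * ((weilArchDensity t * Real.sin (ω * t) : ℝ) : ℂ)) (Ioc 0 (2 * a)) :=
    (integrableOn_weilArchDensity_mul_sin_real ha ω).ofReal.const_mul I
  have hpt : EqOn (fun t : ℝ ↦ (weilArchDensity t : ℂ) * (1 - cexp (I * (ω : ℂ) * (t : ℂ))))
      (fun t ↦ ((weilArchDensity t * (1 - Real.cos (ω * t)) : ℝ) : ℂ) -
        I * ((weilArchDensity t * Real.sin (ω * t) : ℝ) : ℂ)) (Ioc 0 (2 * a)) := fun t _ ↦ by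
    simp only [one_sub_cexp_freq]
    push_cast
    ring
  rw [setIntegral_congr_fun measurableSet_Ioc hpt, integral_sub h1 h2, integral_const_mul, integral_complex_ofReal,
    integral_complex_ofReal]

/-- **`∫_{(0,2a]} ρ(t)(1 − e^{−iωt}) dt = J_c + i J_s`** (`a > 0`). -/
theorem setIntegral_weilArchDensity_mul_one_sub_cexp_neg (ha : 0 < a) (ω : ℝ) :
    ∫ t in Ioc 0 (2 * a), (weilArchDensity t : ℂ) * (1 - cexp (-(I * (ω : ℂ) * (t : ℂ)))) =
      ((∫ t in Ioc 0 (2 * a), weilArchDensity t * (1 - Real.cos (ω * t)) : ℝ) : ℂ) +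
        I * ((∫ t in Ioc 0 (2 * a), weilArchDensity t * Real.sin (ω * t) : ℝ) : ℂ) := by
  have h := setIntegral_weilArchDensity_mul_one_sub_cexp ha (-ω)
  have hl : (fun t : ℝ ↦ (weilArchDensity t : ℂ) * (1 - cexp (I * ((-ω : ℝ) : ℂ) * (t : ℂ)))) =
      fun t : ℝ ↦ (weilArchDensity t : ℂ) * (1 - cexp (-(I * (ω : ℂ) * (t : ℂ)))) := by
    funext t; rw [show I * (((-ω : ℝ)) : ℂ) * (t : ℂ) = -(I * (ω : ℂ) * (t : ℂ)) by push_cast; ring]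
  have hc : (fun t : ℝ ↦ weilArchDensity t * (1 - Real.cos (-ω * t))) = fun t ↦ weilArchDensity t * (1 - Real.cos (ω * t)) := by
    funext t; rw [neg_mul, Real.cos_neg]
  have hs : (fun t : ℝ ↦ weilArchDensity t * Real.sin (-ω * t)) = fun t ↦ -(weilArchDensity t * Real.sin (ω * t)) := by
    funext t; rw [neg_mul, Real.sin_neg]; ring
  rw [hl, hc, hs, integral_neg] at h
  rw [h]
  push_cast
  ring

/-! ## The polynomial kernels `P_q(t) = (a^q − (a−t)^q) + ((−a+t)^q − (−a)^q)` -/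

/-- **Expansion of the mixed polynomial kernel**: `(a^q − (a−t)^q) + ((−a+t)^q − (−a)^q)
= Σ_{l<q} C(q,l+1)((−a)^{q−(l+1)} + (−1)^l a^{q−(l+1)}) t^{l+1}` — no constant term (and identically `0` for even `q`). -/
theorem mixedPolyKernel_eq_sum (q : ℕ) (a t : ℝ) :
    (a ^ q - (a - t) ^ q) + ((-a + t) ^ q - (-a) ^ q) =
      ∑ l ∈ Finset.range q, (q.choose (l + 1) : ℝ) * ((-a) ^ (q - (l + 1)) + (-1) ^ l * a ^ (q - (l + 1))) * t ^ (l + 1) := by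
  have h1 : (a - t) ^ q = ∑ l ∈ Finset.range (q + 1), (-t) ^ l * a ^ (q - l) * (q.choose l : ℝ) := by
    rw [show a - t = -t + a by ring, add_pow]
  have h2 : (-a + t) ^ q = ∑ l ∈ Finset.range (q + 1), t ^ l * (-a) ^ (q - l) * (q.choose l : ℝ) := by
    rw [show -a + t = t + -a by ring, add_pow]
  rw [h1, h2, Finset.sum_range_succ' _ q, Finset.sum_range_succ' (fun l ↦ t ^ l * (-a) ^ (q - l) * (q.choose l : ℝ)) q]
  simp only [pow_zero, Nat.sub_zero, Nat.choose_zero_right, Nat.cast_one, mul_one, one_mul]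
  have h3 : ∑ l ∈ Finset.range q, (q.choose (l + 1) : ℝ) * ((-a) ^ (q - (l + 1)) + (-1) ^ l * a ^ (q - (l + 1))) * t ^ (l + 1) =
      ∑ l ∈ Finset.range q, (t ^ (l + 1) * (-a) ^ (q - (l + 1)) * (q.choose (l + 1) : ℝ) -
        (-t) ^ (l + 1) * a ^ (q - (l + 1)) * (q.choose (l + 1) : ℝ)) := by
    refine Finset.sum_congr rfl fun l _ ↦ ?_
    rw [neg_pow t]
    ring
  rw [h3, Finset.sum_sub_distrib]
  ring

/-- **The archimedean integral of the mixed polynomial kernel through the window constants** (`a > 0`):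
`∫_{(0,2a]} ρ(t) P_q(t) dt = Σ_{l<q} C(q,l+1)((−a)^{q−(l+1)} + (−1)^l a^{q−(l+1)}) · W_{l+1}(a)`,
`W_p(a) = ∫_{(0,2a]} ρ(t) t^p dt` (node series and closed forms in `WeilFormatCPolyWindowArch.lean`). -/
theorem setIntegral_weilArchDensity_mul_mixedPolyKernel (ha : 0 < a) (q : ℕ) :
    ∫ t in Ioc 0 (2 * a), weilArchDensity t * ((a ^ q - (a - t) ^ q) + ((-a + t) ^ q - (-a) ^ q)) =
      ∑ l ∈ Finset.range q, (q.choose (l + 1) : ℝ) * ((-a) ^ (q - (l + 1)) + (-1) ^ l * a ^ (q - (l + 1))) *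
        ∫ t in Ioc 0 (2 * a), weilArchDensity t * t ^ (l + 1) := by
  simp_rw [mixedPolyKernel_eq_sum]
  exact setIntegral_weilArchDensity_mul_sum_pow_succ ha q _

/-- `ρ(t) P_q(t)` is integrable on `(0, 2a]` (`a > 0`). -/
theorem integrableOn_weilArchDensity_mul_mixedPolyKernel (ha : 0 < a) (q : ℕ) :
    IntegrableOn (fun t ↦ weilArchDensity t * ((a ^ q - (a - t) ^ q) + ((-a + t) ^ q - (-a) ^ q))) (Ioc 0 (2 * a)) := by
  simp_rw [mixedPolyKernel_eq_sum, Finset.mul_sum]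
  refine integrable_finsetSum _ fun l _ ↦ ?_
  have h : IntegrableOn (fun t ↦ ((q.choose (l + 1) : ℝ) * ((-a) ^ (q - (l + 1)) + (-1) ^ l * a ^ (q - (l + 1)))) *
      (weilArchDensity t * t ^ (l + 1))) (Ioc 0 (2 * a)) :=
    (integrableOn_weilArchDensity_mul_pow_succ ha l).const_mul _
  exact h.congr_fun (fun t _ ↦ by ring) measurableSet_Ioc

end Summit.RiemannHypothesis.RiemannHypothesis.Theorems.WeilFormatC

end
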